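import Mathlib
import Literature.Probability.LatticeModels.LatticeTaylorConsistency
import Literature.Probability.LatticeModels.LatticePoissonStability
import Literature.Probability.LatticeModels.FlatBoundaryLatticeWindow
import Literature.Analysis.Complex.DiscDirichletProblem
import HarnessLib

/-!
# Limits of lattice-harmonic functions are harmonic (consistency and stability on a disc)

Topic `Literature/Probability/LatticeModels` (discrete potential theory on `δℤ²` → continuum).
The classical fact behind every "discrete harmonic ⇒ harmonic in the scaling limit" statement
(R. Courant, K. Friedrichs, H. Lewy, Math. Ann. 100 (1928), §2–§4; in the sources of the tree's
facts: Chelkak–Smirnov 2011, Prop. 3.1 / proof of Thm. 3.13 "`H^δ ⇉ H`, a harmonic function";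
Kenyon 2000, proof of Lemma 17), in the form

> if lattice functions `u_n`, lattice-harmonic at the mesh points of the open disc `B(z₀, R)`
> (mesh `δ_n → 0`), are uniformly close on the closed disc to a function `H` continuous on the
> closed disc, then `H` coincides on the open disc with the solution `g` of the Dirichlet problem
> with boundary values `H` — in particular `H` is harmonic in `B(z₀, R)`.

* **`eqOn_of_latticeHarmonic_limit`** — the statement above, with the Dirichlet solution `g`
  (`HarmonicContOnCl g (ball z₀ R)`, `g = H` on the circle) as a datum;
  `harmonicOnNhd_of_latticeHarmonic_limit_of_dirichlet` — the corollary "`H` is harmonic on the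
  disc" given such a `g`; **`harmonicOnNhd_of_latticeHarmonic_limit`** — the same with `g`
  supplied by the existence theorem for the disc Dirichlet problem
  (`Literature.Analysis.Complex.harmonicContOnCl_discPoisson`).

Proof (consistency and stability, Kenyon's rendering): on the mesh points of `B(z₀, R - η)` the
error `e = u_n - g∘mesh` has `|Δe| = |Δ(g∘mesh)| ≤ C_η δ_n⁴` (`LatticeTaylorConsistency`), on the
outer boundary `|e| ≤ ‖u_n - H‖ + sup_{annulus} |H - g| ≤ 2ε` (uniform continuity of `H - g`,
which vanishes on the circle), so `|e| ≤ 2ε + C_η δ_n⁴ N_n²/2 ≤ 3ε` by the discrete maximum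
principle (`LatticePoissonStability`, `N_n = (|z₀| + R)/δ_n`); evaluating at the nearest mesh
point of `w` and letting `n → ∞`, `ε → 0` gives `H w = g w`.

Everything is proved, [folklore].
-/

noncomputable section

namespace Literature.Probability.LatticeModels

open _root_.Complex Metric Set Filter InnerProductSpace
open scoped Topology

/-- Radial projection onto the circle: for `a` in the closed disc with `a ≠ z₀`, the point
`b = z₀ + (R/|a - z₀|)(a - z₀)` lies on the circle at distance `R - |a - z₀|` from `a`. [folklore] -/
theorem exists_mem_sphere_dist_eq {z₀ a : ℂ} {R : ℝ} (ha : a ∈ closedBall z₀ R) (ha0 : a ≠ z₀) :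
    ∃ b ∈ sphere z₀ R, dist a b = R - dist a z₀ := by
  have hn : 0 < ‖a - z₀‖ := norm_pos_iff.2 (sub_ne_zero.2 ha0)
  rw [mem_closedBall, dist_eq_norm] at ha
  have hR : 0 ≤ R := hn.le.trans ha
  refine ⟨z₀ + ((R / ‖a - z₀‖ : ℝ) : ℂ) * (a - z₀), ?_, ?_⟩
  · rw [mem_sphere, dist_eq_norm, add_sub_cancel_left, norm_mul, norm_real, Real.norm_eq_abs,
      abs_of_nonneg (div_nonneg hR hn.le), div_mul_cancel₀ _ hn.ne']
  · rw [dist_eq_norm, dist_eq_norm]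
    have : a - (z₀ + ((R / ‖a - z₀‖ : ℝ) : ℂ) * (a - z₀)) =
        ((1 - R / ‖a - z₀‖ : ℝ) : ℂ) * (a - z₀) := by push_cast; ring
    rw [this, norm_mul, norm_real, Real.norm_eq_abs]
    have h1 : 1 - R / ‖a - z₀‖ ≤ 0 := by
      rw [sub_nonpos, le_div_iff₀ hn, one_mul]; exact ha
    rw [abs_of_nonpos h1]
    field_simp
    ring

/-- A continuous function on the closed disc vanishing on the circle is uniformly small on a thin
closed annulus: for `ε > 0` there is `η > 0` (`η ≤ R/2`) with `|D a| < ε` whenever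
`R - η < |a - z₀| ≤ R`. [folklore] -/
theorem exists_annulus_abs_lt {z₀ : ℂ} {R : ℝ} (hR : 0 < R) {D : ℂ → ℝ}
    (hDc : ContinuousOn D (closedBall z₀ R)) (hD0 : ∀ z ∈ sphere z₀ R, D z = 0) {ε : ℝ} (hε : 0 < ε) :
    ∃ η : ℝ, 0 < η ∧ η ≤ R / 2 ∧ ∀ a ∈ closedBall z₀ R, R - η < dist a z₀ → |D a| < ε := by
  have huc := (isCompact_closedBall z₀ R).uniformContinuousOn_of_continuous hDc
  rw [Metric.uniformContinuousOn_iff] at huc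
  obtain ⟨η₁, hη₁, hη₁D⟩ := huc ε hε
  refine ⟨min η₁ (R / 2), lt_min hη₁ (by positivity), min_le_right _ _, fun a ha hda => ?_⟩
  have ha0 : a ≠ z₀ := by
    intro h; rw [h, dist_self] at hda
    linarith [min_le_right η₁ (R / 2)]
  obtain ⟨b, hb, hab⟩ := exists_mem_sphere_dist_eq ha ha0
  have hbcl : b ∈ closedBall z₀ R := sphere_subset_closedBall hb
  have hab' : dist a b < η₁ := by
    rw [hab]; linarith [min_le_left η₁ (R / 2)]
  have := hη₁D a ha b hbcl hab'
  rw [Real.dist_eq, hD0 b hb, sub_zero] at this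
  exact this

/-- **Limits of lattice-harmonic functions solve the Dirichlet problem.** Let `H` be continuous on
the closed disc `closedBall z₀ R`, `g` harmonic in the open disc and continuous on the closed disc
with `g = H` on the circle. Let `u n : ℤ² → ℝ` be lattice-harmonic at every site whose mesh point
(mesh `δ n → 0`) lies in the open disc, and suppose `sup |u n - H ∘ meshPoint (δ n)| → 0` over the
sites whose mesh point lies in the closed disc. Then `H = g` on the open disc. (Courant–Friedrichs–
Lewy 1928; consistency `LatticeTaylorConsistency` + stability `LatticePoissonStability`.) [folklore] -/
theorem eqOn_of_latticeHarmonic_limit {z₀ : ℂ} {R : ℝ} (hR : 0 < R) {H g : ℂ → ℝ}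
    (hH : ContinuousOn H (closedBall z₀ R)) (hg : HarmonicContOnCl g (ball z₀ R))
    (hHg : EqOn H g (sphere z₀ R)) {δ : ℕ → ℝ} (hδ : ∀ n, 0 < δ n)
    (hδ0 : Tendsto δ atTop (𝓝 0)) {u : ℕ → Site 2 → ℝ}
    (hu : ∀ n (v : Site 2), meshPoint (δ n) v ∈ ball z₀ R → latticeLaplacian (u n) v = 0)
    (hconv : ∀ ε > 0, ∀ᶠ n in atTop, ∀ v : Site 2, meshPoint (δ n) v ∈ closedBall z₀ R →
      |u n v - H (meshPoint (δ n) v)| ≤ ε) :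
    EqOn H g (ball z₀ R) := by
  intro w hw
  have hgc : ContinuousOn g (closedBall z₀ R) := hg.continuousOn_ball
  set D : ℂ → ℝ := fun z => H z - g z with hD
  have hDc : ContinuousOn D (closedBall z₀ R) := hH.sub hgc
  have hD0 : ∀ z ∈ sphere z₀ R, D z = 0 := fun z hz => by simp only [hD, hHg hz, sub_self]
  -- the approximating mesh points of `w`
  set p : ℕ → ℂ := fun n => meshPoint (δ n) (nearestSite (δ n) w) with hp
  have hpw : ∀ n, dist (p n) w ≤ δ n := fun n => dist_meshPoint_nearestSite_le (hδ n) w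
  have hp_tend : Tendsto p atTop (𝓝 w) := by
    rw [tendsto_iff_dist_tendsto_zero]
    exact squeeze_zero (fun n => dist_nonneg) hpw hδ0
  have hwR : 0 < R - dist w z₀ := by rw [mem_ball] at hw; linarith
  have hp_mem : ∀ᶠ n in atTop, p n ∈ closedBall z₀ R := by
    filter_upwards [hδ0.eventually (gt_mem_nhds hwR)] with n hn
    rw [mem_closedBall]
    linarith [dist_triangle (p n) w z₀, hpw n]
  have hDw : Tendsto (fun n => D (p n)) atTop (𝓝 (D w)) := by
    have hcw : ContinuousWithinAt D (closedBall z₀ R) w := hDc w (ball_subset_closedBall hw)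
    exact hcw.tendsto.comp (tendsto_nhdsWithin_iff.2 ⟨hp_tend, hp_mem⟩)
  -- it suffices to bound `|D (p n)|` eventually, for every `ε`
  suffices key : ∀ ε > 0, ∀ᶠ n in atTop, |D (p n)| ≤ 4 * ε by
    have hle : ∀ ε > 0, |D w| ≤ 4 * ε := fun ε hε => le_of_tendsto hDw.abs (key ε hε)
    have : |D w| ≤ 0 := by
      by_contra h
      push Not at h
      have := hle (|D w| / 8) (by positivity)
      linarith
    have hDw0 : D w = 0 := abs_nonpos_iff.1 this
    simpa [hD, sub_eq_zero] using hDw0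
  intro ε hε
  -- the annulus on which `|D| < ε`
  obtain ⟨η₁, hη₁, -, hann⟩ := exists_annulus_abs_lt hR hDc hD0 hε
  -- the inner radius `R - η`, with `w ∈ ball z₀ (R - η)`
  set η := min (η₁ / 2) ((R - dist w z₀) / 2) with hη
  have hη0 : 0 < η := lt_min (by positivity) (by positivity)
  have hηη₁ : η < η₁ := lt_of_le_of_lt (min_le_left _ _) (by linarith)
  have hwη : dist w z₀ + η < R := by
    have := min_le_right (η₁ / 2) ((R - dist w z₀) / 2); linarith
  -- consistency constants for `g` on `closedBall z₀ (R - η)`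
  obtain ⟨C, δ₀, hC, hδ₀, hcons⟩ := exists_abs_latticeLaplacian_meshPoint_le_of_harmonicOnNhd
    isOpen_ball hg.harmonicOnNhd (isCompact_closedBall z₀ (R - η))
    (closedBall_subset_ball (by linarith))
  -- the size of the error term
  set M := (‖z₀‖ + R) ^ 2 with hM
  have hM0 : 0 ≤ M := by positivity
  set t₃ := min 1 (ε / (C * M / 2 + 1)) with ht₃
  have ht₃0 : 0 < t₃ := lt_min one_pos (by positivity)
  -- eventually: small mesh and uniform closeness
  have hev1 := hδ0.eventually (gt_mem_nhds hδ₀)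
  have hev2 := hδ0.eventually (gt_mem_nhds hη0)
  have hev3 := hδ0.eventually (gt_mem_nhds ht₃0)
  have hev4 := hδ0.eventually (gt_mem_nhds (show 0 < R - η - dist w z₀ by linarith))
  filter_upwards [hev1, hev2, hev3, hev4, hconv ε hε] with n hn1 hn2 hn3 hn4 hnconv
  set d := δ n with hd
  have hd0 : 0 < d := hδ n
  -- the finite set of sites whose mesh point is in the inner disc
  set S : Set (Site 2) := meshVertices (ball z₀ (R - η)) d with hS
  have hSfin : S.Finite := meshVertices_finite isBounded_ball hd0
  have hmemS : ∀ v : Site 2, v ∈ S ↔ meshPoint d v ∈ ball z₀ (R - η) := fun v => Iff.rfl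
  -- the error function
  set e : Site 2 → ℝ := fun v => u n v - g (meshPoint d v) with he
  -- consistency: `|Δ e| ≤ C d⁴` on `S`
  have hΔ : ∀ v ∈ S, |latticeLaplacian e v| ≤ C * d ^ 4 := by
    intro v hv
    rw [hmemS] at hv
    have hvR : meshPoint d v ∈ ball z₀ R := ball_subset_ball (by linarith) hv
    have h1 : latticeLaplacian e v =
        latticeLaplacian (u n) v - latticeLaplacian (fun x => g (meshPoint d x)) v :=
      latticeLaplacian_sub (u n) (fun x => g (meshPoint d x)) v
    rw [h1, hu n v hvR, zero_sub, abs_neg]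
    exact hcons d hd0 hn1.le v (ball_subset_closedBall hv)
  -- boundary values: `|e| ≤ 2ε` on the outer boundary
  have hB : ∀ w' ∈ latticeOuterBoundary S, |e w'| ≤ 2 * ε := by
    rintro w' ⟨hw'S, v, hvS, k, rfl⟩
    rw [hmemS] at hvS hw'S
    have hdist : dist (meshPoint d (v + cornerUnit k)) z₀ < R - η + d := by
      have := dist_triangle (meshPoint d (v + cornerUnit k)) (meshPoint d v) z₀
      rw [dist_meshPoint_add_cornerUnit hd0 v k] at this
      rw [mem_ball] at hvS
      linarith
    have hcl : meshPoint d (v + cornerUnit k) ∈ closedBall z₀ R := by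
      rw [mem_closedBall]; linarith
    have hfar : R - η₁ < dist (meshPoint d (v + cornerUnit k)) z₀ := by
      rw [mem_ball, not_lt] at hw'S
      linarith
    have h1 : |u n (v + cornerUnit k) - H (meshPoint d (v + cornerUnit k))| ≤ ε := hnconv _ hcl
    have h2 : |D (meshPoint d (v + cornerUnit k))| < ε := hann _ hcl hfar
    simp only [hD] at h2
    calc |e (v + cornerUnit k)|
        = |(u n (v + cornerUnit k) - H (meshPoint d (v + cornerUnit k))) +
            (H (meshPoint d (v + cornerUnit k)) - g (meshPoint d (v + cornerUnit k)))| := by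
          simp only [he]; ring_nf
      _ ≤ |u n (v + cornerUnit k) - H (meshPoint d (v + cornerUnit k))| +
            |H (meshPoint d (v + cornerUnit k)) - g (meshPoint d (v + cornerUnit k))| :=
          abs_add_le _ _
      _ ≤ ε + ε := add_le_add h1 h2.le
      _ = 2 * ε := by ring
  -- the outer boundary lies in the sup-norm box of radius `(|z₀| + R)/d` about `0`
  have hbox : ∀ w' ∈ latticeOuterBoundary S,
      |((w' 0 : ℤ) : ℝ) - (0 : Site 2) 0| ≤ (‖z₀‖ + R) / d ∧
        |((w' 1 : ℤ) : ℝ) - (0 : Site 2) 1| ≤ (‖z₀‖ + R) / d := by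
    rintro w' ⟨hw'S, v, hvS, k, rfl⟩
    rw [hmemS] at hvS
    have hdist : dist (meshPoint d (v + cornerUnit k)) z₀ < R - η + d := by
      have := dist_triangle (meshPoint d (v + cornerUnit k)) (meshPoint d v) z₀
      rw [dist_meshPoint_add_cornerUnit hd0 v k] at this
      rw [mem_ball] at hvS
      linarith
    have hnorm : ‖meshPoint d (v + cornerUnit k)‖ ≤ ‖z₀‖ + R := by
      have := norm_le_norm_add_norm_sub' (meshPoint d (v + cornerUnit k)) z₀
      rw [← dist_eq_norm] at this
      have hηd : d ≤ η := hn2.le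
      linarith
    simp only [Pi.zero_apply, Int.cast_zero, sub_zero]
    constructor
    · have h := (abs_re_le_norm _).trans hnorm
      rw [meshPoint_re, abs_mul, abs_of_pos hd0] at h
      rw [le_div_iff₀ hd0, mul_comm]; exact h
    · have h := (abs_im_le_norm _).trans hnorm
      rw [meshPoint_im, abs_mul, abs_of_pos hd0] at h
      rw [le_div_iff₀ hd0, mul_comm]; exact h
  -- stability
  have hstab : ∀ v ∈ S, |e v| ≤ 2 * ε + C * d ^ 4 * ((‖z₀‖ + R) / d) ^ 2 / 2 := fun v hv =>
    abs_le_of_abs_latticeLaplacian_le hSfin (by positivity) hΔ hB hbox hv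
  -- the error term is at most `ε`
  have herr : C * d ^ 4 * ((‖z₀‖ + R) / d) ^ 2 / 2 ≤ ε := by
    have h1 : C * d ^ 4 * ((‖z₀‖ + R) / d) ^ 2 / 2 = C * M / 2 * d ^ 2 := by
      rw [hM]; field_simp
    rw [h1]
    have hd1 : d ≤ 1 := hn3.le.trans (min_le_left _ _)
    have hd2 : d ^ 2 ≤ d := by nlinarith
    have hdt : d ≤ ε / (C * M / 2 + 1) := hn3.le.trans (min_le_right _ _)
    calc C * M / 2 * d ^ 2 ≤ C * M / 2 * d := mul_le_mul_of_nonneg_left hd2 (by positivity)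
      _ ≤ C * M / 2 * (ε / (C * M / 2 + 1)) := mul_le_mul_of_nonneg_left hdt (by positivity)
      _ = (C * M / 2) / (C * M / 2 + 1) * ε := by ring
      _ ≤ 1 * ε := by
          refine mul_le_mul_of_nonneg_right ?_ hε.le
          rw [div_le_one (by positivity)]; linarith
      _ = ε := one_mul ε
  -- evaluate at the nearest site of `w`
  have hvS : nearestSite d w ∈ S := by
    rw [hmemS, mem_ball]
    have := dist_triangle (meshPoint d (nearestSite d w)) w z₀
    have h2 : dist (meshPoint d (nearestSite d w)) w ≤ d := hpw n
    linarith
  have h3 : |e (nearestSite d w)| ≤ 3 * ε := by linarith [hstab _ hvS]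
  have hpcl : p n ∈ closedBall z₀ R := by
    rw [hmemS] at hvS
    exact ball_subset_closedBall (ball_subset_ball (by linarith) hvS)
  have h4 : |u n (nearestSite d w) - H (p n)| ≤ ε := hnconv _ hpcl
  simp only [he] at h3
  calc |D (p n)| = |(u n (nearestSite d w) - g (p n)) - (u n (nearestSite d w) - H (p n))| := by
        simp only [hD, hp]; ring_nf
    _ ≤ |u n (nearestSite d w) - g (p n)| + |u n (nearestSite d w) - H (p n)| := abs_sub _ _
    _ ≤ 3 * ε + ε := add_le_add h3 h4
    _ = 4 * ε := by ring

/-- **Limits of lattice-harmonic functions are harmonic** (given the Dirichlet solution `g` on the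
disc, cf. `Literature.Analysis.Complex.exists_harmonicContOnCl_eqOn_sphere`): under the hypotheses
of `eqOn_of_latticeHarmonic_limit`, `H` is harmonic on the open disc. [folklore] -/
theorem harmonicOnNhd_of_latticeHarmonic_limit_of_dirichlet {z₀ : ℂ} {R : ℝ} (hR : 0 < R)
    {H g : ℂ → ℝ} (hH : ContinuousOn H (closedBall z₀ R)) (hg : HarmonicContOnCl g (ball z₀ R))
    (hHg : EqOn H g (sphere z₀ R)) {δ : ℕ → ℝ} (hδ : ∀ n, 0 < δ n)
    (hδ0 : Tendsto δ atTop (𝓝 0)) {u : ℕ → Site 2 → ℝ}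
    (hu : ∀ n (v : Site 2), meshPoint (δ n) v ∈ ball z₀ R → latticeLaplacian (u n) v = 0)
    (hconv : ∀ ε > 0, ∀ᶠ n in atTop, ∀ v : Site 2, meshPoint (δ n) v ∈ closedBall z₀ R →
      |u n v - H (meshPoint (δ n) v)| ≤ ε) :
    HarmonicOnNhd H (ball z₀ R) := by
  have heq := eqOn_of_latticeHarmonic_limit hR hH hg hHg hδ hδ0 hu hconv
  intro w hw
  have hev : H =ᶠ[𝓝 w] g := by
    filter_upwards [isOpen_ball.mem_nhds hw] with z hz
    exact heq hz
  rw [harmonicAt_congr_nhds hev]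
  exact hg.harmonicOnNhd w hw

/-- **Limits of lattice-harmonic functions are harmonic.** Let `H` be continuous on the closed
disc `closedBall z₀ R` (`R > 0`), `u n : ℤ² → ℝ` lattice-harmonic at every site whose mesh point
(mesh `δ n → 0⁺`) lies in the open disc, and `sup |u n - H ∘ meshPoint (δ n)| → 0` over the sites
whose mesh point lies in the closed disc. Then `H` is harmonic on the open disc. (Chelkak–Smirnov
2011, Prop. 3.1 / proof of Thm. 3.13; Courant–Friedrichs–Lewy 1928.) [folklore] -/
theorem harmonicOnNhd_of_latticeHarmonic_limit {z₀ : ℂ} {R : ℝ} (hR : 0 < R) {H : ℂ → ℝ}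
    (hH : ContinuousOn H (closedBall z₀ R)) {δ : ℕ → ℝ} (hδ : ∀ n, 0 < δ n)
    (hδ0 : Tendsto δ atTop (𝓝 0)) {u : ℕ → Site 2 → ℝ}
    (hu : ∀ n (v : Site 2), meshPoint (δ n) v ∈ ball z₀ R → latticeLaplacian (u n) v = 0)
    (hconv : ∀ ε > 0, ∀ᶠ n in atTop, ∀ v : Site 2, meshPoint (δ n) v ∈ closedBall z₀ R →
      |u n v - H (meshPoint (δ n) v)| ≤ ε) :
    HarmonicOnNhd H (ball z₀ R) := by
  have hφ : ContinuousOn H (sphere z₀ R) := hH.mono sphere_subset_closedBall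
  exact harmonicOnNhd_of_latticeHarmonic_limit_of_dirichlet hR hH
    (Literature.Analysis.Complex.harmonicContOnCl_discPoisson hR hφ)
    (fun z hz => (Literature.Analysis.Complex.discPoisson_eq_of_mem_sphere hz).symm) hδ hδ0 hu hconv

end Literature.Probability.LatticeModels
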